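import Summits.ResolutionOfSingularities.ResolutionOfSingularities.Theorems.TowerCutSpreadAlg2

/-!
# TowerCut (T6/8) — stage 0 at ring level: the chart laws of the blow-up of the curve at a spread point (`spread_zChart`, `spread_uChart`)

see `Theorems/MaxContactCutTowerCut.lean` (slice T8) for the main theorem `spreadExit_holds : SpreadExit`, the mechanism and the
sources ([Hironaka1964], [CossartJannsenSaito2020], [CutkoskyBook2004] §7).  `decomp-res-lens-2` g29, node «TowerCut».
-/

open CategoryTheory AlgebraicGeometry IsLocalRing TopologicalSpace Topology
open Literature.AlgebraicGeometry.Resolution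
open Summit.ResolutionOfSingularities.ResolutionOfSingularities.Theorems
open Summit.ResolutionOfSingularities.ResolutionOfSingularities.Theorems.WeakOrderReduction
open Summit.ResolutionOfSingularities.ResolutionOfSingularities.Theorems.DeltaFaceCutClasses
open Summit.ResolutionOfSingularities.ResolutionOfSingularities.Theorems.RelativeDeltaCut
open Summit.ResolutionOfSingularities.ResolutionOfSingularities.Theorems.SpreadCut

namespace Summit.ResolutionOfSingularities.ResolutionOfSingularities.Theorems.TowerCut

/-! ## §7  STAGE 0 (ring level): the chart laws of the blow-up of the CURVE `C` at a spread point

At a closed point `y` of the uniform spread curve, in the frame `(c₀, c₁, c₂, v)` of `IsSpreadAt`, blow up the curve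
stalk `P = (c₀, c₁, c₂)`: in the `c₀`-chart `(I𝒪 : tⁿ) = (1)`; in the `c_i`-chart (`i = 1, 2`) either `(I𝒪 : tⁿ) = (1)`
(off `e₀ ∈ 𝔴`) or STAGE SHAPE DATA with `a = m - n` (`z = e₀`, `u = t`, `φ =` the face polynomial `lowerChart`/`upperChart`
evaluated at `e_k`, whose transversality is §5). -/

section SpreadChart

open Polynomial

variable {A : Type} [CommRing A]

/-- `σ` of the binary form. -/
theorem map_binForm {S : Type} [CommRing S] (σ : A →+* S) (u₁ u₂ : A) (G : ℕ → A) (m : ℕ) :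
    σ (binForm u₁ u₂ G m) = binForm (σ u₁) (σ u₂) (fun j => σ (G j)) m := by
  simp only [binForm, map_sum, map_mul, map_pow]

/-- Homogeneity of the binary form: `F(t a, t b) = tᵐ F(a, b)`. -/
theorem binForm_mul_mul (t a b : A) (G : ℕ → A) (m : ℕ) :
    binForm (t * a) (t * b) G m = t ^ m * binForm a b G m := by
  simp only [binForm, Finset.mul_sum]
  refine Finset.sum_congr rfl fun j hj => ?_
  have hj' : j ≤ m := Nat.lt_succ_iff.mp (Finset.mem_range.mp hj)
  have ht : t ^ j * t ^ (m - j) = t ^ m := by rw [← pow_add, Nat.add_sub_cancel' hj']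
  calc G j * (t * a) ^ j * (t * b) ^ (m - j) = t ^ j * t ^ (m - j) * (G j * a ^ j * b ^ (m - j)) := by ring
    _ = t ^ m * (G j * a ^ j * b ^ (m - j)) := by rw [ht]

/-- The binary form in the chart where `c₂ ↦ t`: `σ F(c₁, c₂) = tᵐ · θ(lowerChart)` (`θ : A[X] → S`, `X ↦ e₁`).
[folklore] -/
theorem map_binForm_eq_lower {S : Type} [CommRing S] (σ : A →+* S) (θ : A[X] →+* S)
    (hθC : ∀ a, θ (C a) = σ a) (c₁ c₂ : A) (t : S) (h1 : σ c₁ = t * θ X) (h2 : σ c₂ = t)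
    (G : ℕ → A) (m : ℕ) : σ (binForm c₁ c₂ G m) = t ^ m * θ (lowerChart G m) := by
  simp only [binForm, lowerChart, map_sum, Finset.mul_sum]
  refine Finset.sum_congr rfl fun j hj => ?_
  have hj' : j ≤ m := Nat.lt_succ_iff.mp (Finset.mem_range.mp hj)
  have ht : t ^ j * t ^ (m - j) = t ^ m := by rw [← pow_add, Nat.add_sub_cancel' hj']
  rw [map_mul, map_mul, map_pow, map_pow, h1, h2, map_mul, map_pow, hθC, mul_pow]
  calc σ (G j) * (t ^ j * θ X ^ j) * t ^ (m - j) = t ^ j * t ^ (m - j) * (σ (G j) * θ X ^ j) := by ring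
    _ = t ^ m * (σ (G j) * θ X ^ j) := by rw [ht]

/-- The binary form in the chart where `c₁ ↦ t`: `σ F(c₁, c₂) = tᵐ · θ(upperChart)` (`θ : A[X] → S`, `X ↦ e₂`).
[folklore] -/
theorem map_binForm_eq_upper {S : Type} [CommRing S] (σ : A →+* S) (θ : A[X] →+* S)
    (hθC : ∀ a, θ (C a) = σ a) (c₁ c₂ : A) (t : S) (h1 : σ c₁ = t) (h2 : σ c₂ = t * θ X)
    (G : ℕ → A) (m : ℕ) : σ (binForm c₁ c₂ G m) = t ^ m * θ (upperChart G m) := by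
  simp only [binForm, upperChart, map_sum, Finset.mul_sum]
  refine Finset.sum_congr rfl fun j hj => ?_
  have hj' : j ≤ m := Nat.lt_succ_iff.mp (Finset.mem_range.mp hj)
  have ht : t ^ j * t ^ (m - j) = t ^ m := by rw [← pow_add, Nat.add_sub_cancel' hj']
  rw [map_mul, map_mul, map_pow, map_pow, h1, h2, map_mul, map_pow, hθC, mul_pow]
  calc σ (G j) * t ^ j * (t ^ (m - j) * θ X ^ (m - j)) = t ^ j * t ^ (m - j) * (σ (G j) * θ X ^ (m - j)) := by ring
    _ = t ^ m * (σ (G j) * θ X ^ (m - j)) := by rw [ht]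

variable [IsRegularLocalRing A] {J : Ideal A} {n m : ℕ}

/-- **Stage 0, the `c₀`-chart**: `(J𝒪 : tⁿ) = (1)` (`σf/tⁿ = 1 + t^{m-n}·F' + t·r` is a unit since `n < m`). [folklore] -/
theorem spread_zChart (c : Fin 3 → A) (v g f : A) (G : ℕ → A)
    (hW : Ideal.span (Set.range (Fin.append c ![v])) = maximalIdeal A)
    (hn : 2 ≤ n) (hnm : 2 * n ≤ m + 1) (hfJ : f ∈ J) (hf : f = c 0 ^ n + binForm (c 1) (c 2) G m + g)
    (hg : g ∈ qWeighted c m n (m * n + 1))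
    (𝔴 : PrimeSpectrum (chartRing c 0)) {S : Type} [CommRing S] [IsLocalRing S]
    (χ : chartRing c 0 →+* S) (hlocχ : @IsLocalization.AtPrime _ _ S _ χ.toAlgebra 𝔴.asIdeal _)
    (h𝔴 : 𝔴.asIdeal.comap (chartBase c 0) = maximalIdeal A)
    (σ : A →+* S) (hσ : ∀ x, χ (chartBase c 0 x) = σ x) :
    Submodule.colon (J.map σ) ((Ideal.span {σ (c 0)} ^ n : Ideal S) : Set S) = ⊤ := by
  letI := χ.toAlgebra
  haveI : IsLocalization.AtPrime S 𝔴.asIdeal := hlocχ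
  have halg : ∀ b, algebraMap (chartRing c 0) S b = χ b := fun b =>
    RingHom.congr_fun (RingHom.algebraMap_toAlgebra χ) b
  have hcm : ∀ j, c j ∈ maximalIdeal A := fun j => hW ▸ Ideal.subset_span ⟨Fin.castAdd 1 j, by simp⟩
  set ε : Fin 3 → S := fun l => χ (chartGen c 0 l) with hε
  have hu : ∀ l, σ (c l) = σ (c 0) * ε l := fun l => by
    rw [hε, ← hσ, ← hσ, ← map_mul, ← reesChartBase_apply_eq_mul_chartGen c 0 l]
  have hloc : ∀ x : A, σ x ∈ maximalIdeal S ↔ x ∈ maximalIdeal A := fun x => by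
    rw [← hσ, ← halg, IsLocalization.AtPrime.to_map_mem_maximal_iff S 𝔴.asIdeal, ← Ideal.mem_comap, h𝔴]
  set t := σ (c 0) with ht
  have htm : t ∈ maximalIdeal S := (hloc _).mpr (hcm 0)
  obtain ⟨a', ha'⟩ : ∃ a', m = n + 1 + a' := ⟨m - (n + 1), by omega⟩
  -- `σ g ∈ (t^{n+1})`
  have hgP : g ∈ Ideal.span (Set.range c) ^ (n + 1) :=
    qWeighted_le_pow_of_lt c (by omega) (N := n) (l := m * n + 1) (by rw [Nat.mul_comm]; exact Nat.lt_succ_self _) hg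
  have hσg : σ g ∈ Ideal.span {t ^ (n + 1)} := by
    have h := Ideal.mem_map_of_mem σ hgP
    rwa [Ideal.map_pow, Ideal.map_span_range_eq_span_singleton σ c 0 ε hu, Ideal.span_singleton_pow] at h
  obtain ⟨r, hr⟩ := Ideal.mem_span_singleton'.mp hσg
  -- `σ F = tᵐ · F'`
  have hB : σ (binForm (c 1) (c 2) G m) = t ^ m * binForm (ε 1) (ε 2) (fun j => σ (G j)) m := by
    rw [map_binForm, hu 1, hu 2, binForm_mul_mul]
  have hf' : σ f = t ^ n * (1 + t ^ (1 + a') * binForm (ε 1) (ε 2) (fun j => σ (G j)) m + t * r) := by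
    rw [hf, map_add, map_add, map_pow, hB, ← hr, ha']
    ring
  have hmem := mem_colon_of_map_eq σ hfJ hf'
  refine Ideal.eq_top_of_isUnit_mem _ hmem ?_
  rw [add_assoc]
  refine isUnit_add_of_mem isUnit_one (Ideal.add_mem _ ?_ (Ideal.mul_mem_right _ _ htm))
  rw [pow_add, pow_one, mul_assoc]
  exact Ideal.mul_mem_right _ _ htm

/-- **Stage 0, the `c_i`-chart** (`i = 1, 2`): either `(J𝒪 : tⁿ) = (1)` (off `e₀ ∈ 𝔴`) or STAGE SHAPE DATA with
`a = m - n`: `z = e₀`, `u = t = σ c_i`, `φ = θ(face polynomial)`, tail and `J' ⊆ Q'(n(m-n))` from the chart law and the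
colon, the parameters from the Rees-chart family and, for `φ`, from RELATIVE SIMPLICITY (§5). [folklore] -/
theorem spread_uChart (c : Fin 3 → A) (v g f : A) (G : ℕ → A) (i k : Fin 3) (h0i : (0 : Fin 3) ≠ i)
    (hki : k ≠ i) (hk0 : k ≠ 0)
    (hW : Ideal.span (Set.range (Fin.append c ![v])) = maximalIdeal A) (hd : (maximalIdeal A).spanFinrank = 3 + 1)
    (hn : 2 ≤ n) (hnm : 2 * n ≤ m + 1) (hfJ : f ∈ J) (hf : f = c 0 ^ n + binForm (c 1) (c 2) G m + g)
    (hg : g ∈ qWeighted c m n (m * n + 1)) (hJ : J ≤ qWeighted c m n (m * n))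
    (φ : A[X]) (hφ : RelSimple (Ideal.span (Set.range c)) (maximalIdeal A) φ)
    (𝔴 : PrimeSpectrum (chartRing c i)) {S : Type} [CommRing S] [IsLocalRing S]
    (χ : chartRing c i →+* S) (hlocχ : @IsLocalization.AtPrime _ _ S _ χ.toAlgebra 𝔴.asIdeal _)
    (h𝔴 : 𝔴.asIdeal.comap (chartBase c i) = maximalIdeal A)
    (σ : A →+* S) (hσ : ∀ x, χ (chartBase c i x) = σ x)
    (hbin : σ (binForm (c 1) (c 2) G m) = σ (c i) ^ m * χ (eval₂RingHom (chartBase c i) (chartGen c i k) φ)) :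
    Submodule.colon (J.map σ) ((Ideal.span {σ (c i)} ^ n : Ideal S) : Set S) = ⊤ ∨
      Nonempty (ShapeData (Submodule.colon (J.map σ) ((Ideal.span {σ (c i)} ^ n : Ideal S) : Set S))
        (Ideal.span {σ (c i)}) n (m - n)) := by
  letI := χ.toAlgebra
  haveI : IsLocalization.AtPrime S 𝔴.asIdeal := hlocχ
  have halg : ∀ b, algebraMap (chartRing c i) S b = χ b := fun b =>
    RingHom.congr_fun (RingHom.algebraMap_toAlgebra χ) b
  have hcm : ∀ j, c j ∈ maximalIdeal A := fun j => hW ▸ Ideal.subset_span ⟨Fin.castAdd 1 j, by simp⟩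
  set ε : Fin 3 → S := fun l => χ (chartGen c i l) with hε
  have hu : ∀ l, σ (c l) = σ (c i) * ε l := fun l => by
    rw [hε, ← hσ, ← hσ, ← map_mul, ← reesChartBase_apply_eq_mul_chartGen c i l]
  have hloc : ∀ x : A, σ x ∈ maximalIdeal S ↔ x ∈ maximalIdeal A := fun x => by
    rw [← hσ, ← halg, IsLocalization.AtPrime.to_map_mem_maximal_iff S 𝔴.asIdeal, ← Ideal.mem_comap, h𝔴]
  set t := σ (c i) with ht
  set Φ := χ (eval₂RingHom (chartBase c i) (chartGen c i k) φ) with hΦ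
  have htm : t ∈ maximalIdeal S := (hloc _).mpr (hcm i)
  have hσz : σ (c 0) = t * ε 0 := hu 0
  obtain ⟨a', ha'⟩ : ∃ a', m = n + a' := ⟨m - n, by omega⟩
  have ha'1 : 1 ≤ a' := by omega
  have han : m - n = a' := by omega
  rw [han]
  -- the chart law: `J S ⊆ tⁿ · Q'(n a')`, `σ g ∈ tⁿ · Q'(n a' + 1)`
  have hlaw1 := map_qWeighted_le_chart σ c i ε hu (a := m) (b := n) (l := m * n) (N := n) (by omega) (by omega)
    (by rw [Nat.mul_comm])
  have hlaw2 := map_qWeighted_le_chart σ c i ε hu (a := m) (b := n) (l := m * n + 1) (N := n) (by omega)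
    (by omega) (by rw [Nat.mul_comm]; exact Nat.le_succ _)
  have hl1 : m * n - n * n = n * a' := by rw [ha', Nat.add_mul, Nat.mul_comm a' n]; omega
  have hl2 : m * n + 1 - n * n = n * a' + 1 := by rw [ha', Nat.add_mul, Nat.mul_comm a' n]; omega
  rw [hl1, han] at hlaw1
  rw [hl2, han] at hlaw2
  have hJ' : J.map σ ≤ Ideal.span {t ^ n} * qWeighted ![ε 0, t] a' n (n * a') := (Ideal.map_mono hJ).trans hlaw1
  obtain ⟨g'', hg'', hg''e⟩ := Ideal.mem_span_singleton_mul.mp (hlaw2 (Ideal.mem_map_of_mem σ hg))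
  -- `σ g ∈ (t^{n+1})` as well
  have hgP : g ∈ Ideal.span (Set.range c) ^ (n + 1) :=
    qWeighted_le_pow_of_lt c (by omega) (N := n) (l := m * n + 1) (by rw [Nat.mul_comm]; exact Nat.lt_succ_self _) hg
  have hσg : σ g ∈ Ideal.span {t ^ (n + 1)} := by
    have h := Ideal.mem_map_of_mem σ hgP
    rwa [Ideal.map_pow, Ideal.map_span_range_eq_span_singleton σ c i ε hu, Ideal.span_singleton_pow] at h
  obtain ⟨r, hr⟩ := Ideal.mem_span_singleton'.mp hσg
  by_cases h0 : chartGen c i 0 ∈ 𝔴.asIdeal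
  · -- stage shape data with `a' = m - n`
    right
    have hrsop2 : IsRsopPart ![ε 0, t] := by
      have h := isRsopPart_pair_chart0 c ![v] hW hd i h0i 𝔴 S h𝔴 h0
      simpa only [halg, hσ, hε, ht] using h
    have hrsop3 : Φ ∈ maximalIdeal S → IsRsopPart ![ε 0, t, Φ] := fun hΦm => by
      have h := isRsopPart_of_relSimple c v hW hd i k h0i hki hk0 𝔴 χ hlocχ h𝔴 h0 φ hφ hΦm
      simpa only [hσ, hε, ht, hΦ] using h
    haveI : IsRegularLocalRing S := hrsop2.isRegularLocalRing
    haveI := isDomain_of_isRegularLocalRing S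
    have ht0 : t ∈ nonZeroDivisors S := mem_nonZeroDivisors_of_ne_zero (hrsop2.ne_zero 1)
    have hf' : σ f = t ^ n * (ε 0 ^ n + t ^ a' * Φ + g'') := by
      rw [hf, map_add, map_add, map_pow, hσz, hbin, ← hg''e, ha']
      ring
    exact ⟨{ z := ε 0
             u := t
             φ := Φ
             g := g''
             rsop := hrsop2
             exc := rfl
             mem := mem_colon_of_map_eq σ hfJ hf'
             tail := hg''
             deep := colon_le_of_le_span_pow_mul ht0 hJ'
             simple := hrsop3 }⟩
  · -- `e₀` is a unit: `σf/tⁿ` is a unit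
    left
    have hunit : IsUnit (ε 0) := by
      rw [hε]; dsimp only; rw [← halg]
      exact IsLocalization.map_units S (⟨chartGen c i 0, h0⟩ : 𝔴.asIdeal.primeCompl)
    have hf' : σ f = t ^ n * (ε 0 ^ n + t ^ a' * Φ + t * r) := by
      rw [hf, map_add, map_add, map_pow, hσz, hbin, ← hr, ha']
      ring
    refine Ideal.eq_top_of_isUnit_mem _ (mem_colon_of_map_eq σ hfJ hf') ?_
    rw [add_assoc]
    refine isUnit_add_of_mem (hunit.pow n) (Ideal.add_mem _ ?_ (Ideal.mul_mem_right _ _ htm))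
    obtain ⟨a'', rfl⟩ : ∃ a'', a' = a'' + 1 := ⟨a' - 1, by omega⟩
    rw [pow_succ, mul_assoc]
    exact Ideal.mul_mem_left _ _ (Ideal.mul_mem_right _ _ htm)

end SpreadChart

end Summit.ResolutionOfSingularities.ResolutionOfSingularities.Theorems.TowerCut
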